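import Literature.MathematicalPhysics.KineticTheory.CollisionTubePairMeanLowerBound
import Literature.Analysis.FluidPDE.LambertCosineLaw
import Summits.AtomisticToContinuum.HydrodynamicLimit.Theorems.JParityClosureKineticEnergyTailsApriori
import HarnessLib

/-!
# Splitting floor at rung 0 (helper of `stub_splitFloorRung0`, line `level-census-comparison`, crux
# `EnergyCurrentTails`, stmt-AtomisticToContinuum-9235): the splitting geometry of an energetic sphere

For a level `E`, the SPLITTING collisions of the line are those whose faster incoming participant has energy
in `(E, 3E/2]` and both outgoing energies are `≤ E` (`splitEvent E` of `…LevelCensusObjects`, inlined).  This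
file supplies, for the Maxwellian `N(u, θ)` and every `E` above an explicit threshold, a MEASURABLE mark
`Ξ_E(n, v, w) ∈ {0, 1}` on (impact normal, incoming velocities) which is nonzero only on the splitting
geometry of the outgoing pair `(v − ⟪v − w, n⟫ n, w + ⟪v − w, n⟫ n)` (elastic law at a UNIT normal), carries
the speed cutoffs `‖v − w‖, ‖v‖ < 4√E`, and has the GEOMETRIC FLOOR
`c √E · N(u,θ)(E < ‖v‖² ≤ 3E/2) ≤ Θ̄_{Ξ_E} = ∫∫ Θ Ξ_E (v, w) M(v) M(w)` with `c = c(u, θ) > 0` independent of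
`E` (registered helper `splitFloorRung0_geometry`).  Proof: for `v` in the shell and a SLOW partner `‖w‖ < R`
(`R² = 2(‖u‖² + 3θ) + 1`, probability `≥ 1/2` by Chebyshev) every unit normal at cosine `⟪a, ω⟫ ∈ [13/20, 3/4]`
to `a = (w − v)/‖w − v‖` is splitting once `√E ≥ 40R` (`split_of_zone`); the flux of this zone is, by the
tree's flux form of Archimedes' hat-box theorem (`lintegral_toSphere_cos_comp_coords`), the area `c_Z > 0` of a
planar annulus, independent of `a`; so `Θ Ξ_E (v, w) ≥ ‖w − v‖ c_Z ≥ (√E/2) c_Z` there, and `c = c_Z/4`.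

References: C. Cercignani, R. Illner, M. Pulvirenti (1994) §2.2 (collision cylinder); Archimedes (hat-box).
-/

noncomputable section

open MeasureTheory ProbabilityTheory Set Filter Topology Function Metric
open scoped ENNReal InnerProductSpace BigOperators

namespace Summit.AtomisticToContinuum.HydrodynamicLimit.Theorems.EnergyCurrentTailsLevelCensus

open Literature.MathematicalPhysics.KineticTheory Literature.Analysis.FluidPDE

/-! ## Kinematics of the elastic law at a unit normal -/

/-- Energy conservation of the elastic law at a unit normal: with `c = ⟪v − w, ω⟫`,
`‖v − c ω‖² + ‖w + c ω‖² = ‖v‖² + ‖w‖²`. [folklore] -/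
theorem norm_sq_post_add {ω : V3} (hω : ‖ω‖ = 1) (v w : V3) :
    ‖v - ⟪v - w, ω⟫_ℝ • ω‖ ^ 2 + ‖w + ⟪v - w, ω⟫_ℝ • ω‖ ^ 2 = ‖v‖ ^ 2 + ‖w‖ ^ 2 := by
  set c := ⟪v - w, ω⟫_ℝ with hc
  have hcω : ‖c • ω‖ ^ 2 = c ^ 2 := by rw [norm_smul, hω, mul_one, Real.norm_eq_abs, sq_abs]
  have h1 : ‖v - c • ω‖ ^ 2 = ‖v‖ ^ 2 - 2 * (c * ⟪v, ω⟫_ℝ) + c ^ 2 := by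
    rw [norm_sub_sq_real, hcω, inner_smul_right]
  have h2 : ‖w + c • ω‖ ^ 2 = ‖w‖ ^ 2 + 2 * (c * ⟪w, ω⟫_ℝ) + c ^ 2 := by
    rw [norm_add_sq_real, hcω, inner_smul_right]
  have h3 : c = ⟪v, ω⟫_ℝ - ⟪w, ω⟫_ℝ := by rw [hc, inner_sub_left]
  rw [h1, h2]
  linear_combination (2 * c) * h3

/-- **The splitting zone.**  If `0 < R`, `40 R ≤ e`, `e² < ‖v‖² ≤ (3/2) e²`, `‖w‖ < R`, `‖ω‖ = 1` and
`13/20 ≤ ⟪a, ω⟫ ≤ 3/4` (`a = ‖w − v‖⁻¹ (w − v)`), then with `c = ⟪v − w, ω⟫` the outgoing pair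
`(v − c ω, w + c ω)` has both energies `≤ e²`, the faster incoming energy is `‖v‖²`, and `‖v − w‖, ‖v‖ < 4e`. [folklore] -/
theorem split_of_zone {R e : ℝ} (hR : 0 < R) (hRe : 40 * R ≤ e) {v w ω : V3} (hv1 : e ^ 2 < ‖v‖ ^ 2)
    (hv2 : ‖v‖ ^ 2 ≤ 3 / 2 * e ^ 2) (hw : ‖w‖ < R) (hω : ‖ω‖ = 1)
    (ht1 : 13 / 20 ≤ ⟪‖w - v‖⁻¹ • (w - v), ω⟫_ℝ) (ht2 : ⟪‖w - v‖⁻¹ • (w - v), ω⟫_ℝ ≤ 3 / 4) :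
    e ^ 2 < max (‖v‖ ^ 2) (‖w‖ ^ 2) ∧ max (‖v‖ ^ 2) (‖w‖ ^ 2) ≤ 3 / 2 * e ^ 2 ∧
      ‖v - ⟪v - w, ω⟫_ℝ • ω‖ ^ 2 ≤ e ^ 2 ∧ ‖w + ⟪v - w, ω⟫_ℝ • ω‖ ^ 2 ≤ e ^ 2 ∧
      ‖v - w‖ < 2 * (2 * e) ∧ ‖v‖ < 2 * (2 * e) := by
  have he : 0 < e := by linarith
  have hr0 : 0 ≤ ‖v‖ := norm_nonneg v
  have hr1 : e < ‖v‖ := by nlinarith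
  have hr2 : ‖v‖ ≤ 5 / 4 * e := by nlinarith
  have hw0 : 0 ≤ ‖w‖ := norm_nonneg w
  set g : V3 := w - v with hg
  have hg1 : ‖v‖ - ‖w‖ ≤ ‖g‖ := by rw [hg, norm_sub_rev]; exact norm_sub_norm_le v w
  have hg2 : ‖g‖ ≤ ‖w‖ + ‖v‖ := norm_sub_le w v
  have hgpos : 0 < ‖g‖ := by linarith
  -- `c = -‖g‖ t`
  set t := ⟪‖w - v‖⁻¹ • (w - v), ω⟫_ℝ with htdef
  have hct : ⟪v - w, ω⟫_ℝ = -(‖g‖ * t) := by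
    rw [htdef, real_inner_smul_left, ← hg, ← mul_assoc, mul_inv_cancel₀ hgpos.ne', one_mul,
      ← inner_neg_left, neg_sub]
  set c := ⟪v - w, ω⟫_ℝ with hcdef
  have hcn : ‖c • ω‖ = ‖g‖ * t := by
    rw [norm_smul, hω, mul_one, hct, Real.norm_eq_abs, abs_neg, abs_of_nonneg]
    exact mul_nonneg hgpos.le (by linarith)
  have hup : ‖w + c • ω‖ ≤ ‖w‖ + ‖g‖ * t := by rw [← hcn]; exact norm_add_le _ _
  have hlo : ‖g‖ * t - ‖w‖ ≤ ‖w + c • ω‖ := by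
    have := norm_sub_norm_le (c • ω) (-w)
    rwa [norm_neg, sub_neg_eq_add, add_comm, hcn] at this
  have hU : ‖w‖ + ‖g‖ * t ≤ e := by
    have h1 : ‖g‖ * t ≤ (‖w‖ + ‖v‖) * (3 / 4) := mul_le_mul hg2 ht2 (by linarith) (by linarith)
    nlinarith
  have hpost2 : ‖w + c • ω‖ ^ 2 ≤ e ^ 2 := by
    have h0 : 0 ≤ ‖w + c • ω‖ := norm_nonneg _
    nlinarith [hup.trans hU]
  have hL1 : 13 / 20 * ‖v‖ - 33 / 20 * R ≤ ‖g‖ * t - ‖w‖ := by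
    have h1 : (‖v‖ - ‖w‖) * (13 / 20) ≤ ‖g‖ * t := mul_le_mul hg1 ht1 (by norm_num) hgpos.le
    nlinarith
  have hL1pos : 0 ≤ 13 / 20 * ‖v‖ - 33 / 20 * R := by nlinarith
  have hkey : ‖v‖ ^ 2 + R ^ 2 - e ^ 2 ≤ (13 / 20 * ‖v‖ - 33 / 20 * R) ^ 2 := by
    have hB : ‖v‖ * R ≤ 5 / 4 * e * R := mul_le_mul_of_nonneg_right hr2 hR.le
    have hC : 40 * R * e ≤ e * e := mul_le_mul_of_nonneg_right hRe he.le
    have hsq : (13 / 20 * ‖v‖ - 33 / 20 * R) ^ 2 =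
        169 / 400 * ‖v‖ ^ 2 - 429 / 200 * (‖v‖ * R) + 1089 / 400 * R ^ 2 := by ring
    have hRe' : 40 * R * e = 40 * (e * R) := by ring
    rw [hsq]; rw [hRe'] at hC
    nlinarith [hB, hC, hv2, sq_nonneg R, sq e]
  have hpost2lo : ‖v‖ ^ 2 + ‖w‖ ^ 2 - e ^ 2 ≤ ‖w + c • ω‖ ^ 2 := by
    have h1 : (13 / 20 * ‖v‖ - 33 / 20 * R) ^ 2 ≤ ‖w + c • ω‖ ^ 2 :=
      pow_le_pow_left₀ hL1pos (hL1.trans hlo) 2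
    have h2 : ‖w‖ ^ 2 ≤ R ^ 2 := pow_le_pow_left₀ hw0 hw.le 2
    linarith
  have hpost1 : ‖v - c • ω‖ ^ 2 ≤ e ^ 2 := by
    have hcons := norm_sq_post_add hω v w; rw [← hcdef] at hcons; linarith
  have hmax : max (‖v‖ ^ 2) (‖w‖ ^ 2) = ‖v‖ ^ 2 := max_eq_left (by nlinarith)
  refine ⟨by rw [hmax]; exact hv1, by rw [hmax]; exact hv2, hpost1, hpost2, ?_, ?_⟩
  · calc ‖v - w‖ = ‖g‖ := by rw [hg, norm_sub_rev]
      _ ≤ ‖w‖ + ‖v‖ := hg2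
      _ < 2 * (2 * e) := by linarith
  · linarith

/-! ## The flux of the splitting zone: Archimedes' hat-box theorem -/

/-- The planar annulus `7/16 ≤ ‖p‖² ≤ 231/400` is measurable. [folklore] -/
theorem measurableSet_zoneAnnulus :
    MeasurableSet {p : EuclideanSpace ℝ (Fin 2) | 7 / 16 ≤ ‖p‖ ^ 2 ∧ ‖p‖ ^ 2 ≤ 231 / 400} := by
  have h : Measurable fun p : EuclideanSpace ℝ (Fin 2) => ‖p‖ ^ 2 := by fun_prop
  rw [Set.setOf_and]
  exact (measurableSet_le measurable_const h).inter (measurableSet_le h measurable_const)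

/-- **The flux of the splitting zone is the area of a planar annulus** (hat-box theorem in flux form,
`lintegral_toSphere_cos_comp_coords`; on the sphere `‖coords a ν‖² = 1 − ⟪a, ν⟫²`): for a unit vector `a`,
`∫_{S²} ⟪a, ν⟫₊ 𝟙{13/20 ≤ ⟪a, ν⟫ ≤ 3/4} dσ(ν) = |{p ∈ B_{ℝ²}(0,1) : 7/16 ≤ ‖p‖² ≤ 231/400}|`. [folklore] -/
theorem lintegral_zoneFlux_eq {a : V3} (ha : ‖a‖ = 1) :
    ∫⁻ ν : Metric.sphere (0 : V3) 1, ENNReal.ofReal ⟪a, (ν : V3)⟫_ℝ *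
        (Set.Icc (13 / 20 : ℝ) (3 / 4)).indicator 1 ⟪a, (ν : V3)⟫_ℝ ∂sphereMeasure =
      volume ({p : EuclideanSpace ℝ (Fin 2) | 7 / 16 ≤ ‖p‖ ^ 2 ∧ ‖p‖ ^ 2 ≤ 231 / 400} ∩ Metric.ball 0 1) := by
  set A : Set (EuclideanSpace ℝ (Fin 2)) := {p | 7 / 16 ≤ ‖p‖ ^ 2 ∧ ‖p‖ ^ 2 ≤ 231 / 400} with hAdef
  have hA : MeasurableSet A := measurableSet_zoneAnnulus
  have h := lintegral_toSphere_cos_comp_coords ha (f := A.indicator 1) (measurable_one.indicator hA)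
  rw [lintegral_indicator_one hA, Measure.restrict_apply hA] at h
  have hsm : (sphereMeasure : Measure (Metric.sphere (0 : V3) 1)) = volume.toSphere := rfl
  rw [hsm, ← h]
  refine lintegral_congr fun ν => ?_
  have hν : ‖(ν : V3)‖ = 1 := by simp
  set t := ⟪a, (ν : V3)⟫_ℝ with htdef
  by_cases ht : t < 0
  · rw [ENNReal.ofReal_of_nonpos ht.le, zero_mul, zero_mul]
  · push Not at ht
    congr 1
    have hc : ‖Lambert.coords a ν‖ ^ 2 = 1 - t ^ 2 := Lambert.norm_sq_coords_of_norm_eq_one ha hν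
    by_cases hmem : t ∈ Set.Icc (13 / 20 : ℝ) (3 / 4)
    · rw [Set.indicator_of_mem hmem]
      have hmem' : Lambert.coords a ν ∈ A := by
        simp only [hAdef, Set.mem_setOf_eq, hc]
        constructor <;> nlinarith [hmem.1, hmem.2]
      rw [Set.indicator_of_mem hmem']
      rfl
    · rw [Set.indicator_of_notMem hmem]
      have hmem' : Lambert.coords a ν ∉ A := by
        intro h'
        simp only [hAdef, Set.mem_setOf_eq, hc] at h'
        apply hmem
        constructor <;> nlinarith [h'.1, h'.2]
      rw [Set.indicator_of_notMem hmem']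

/-- The area of the annulus is positive (it contains the disc of radius `1/50` about `(7/10, 0)`). [folklore] -/
theorem zoneArea_pos :
    0 < volume ({p : EuclideanSpace ℝ (Fin 2) | 7 / 16 ≤ ‖p‖ ^ 2 ∧ ‖p‖ ^ 2 ≤ 231 / 400} ∩ Metric.ball 0 1) := by
  set p₀ : EuclideanSpace ℝ (Fin 2) := PiLp.single 2 (0 : Fin 2) (7 / 10 : ℝ) with hp₀
  have hn : ‖p₀‖ = 7 / 10 := by
    rw [hp₀, PiLp.norm_single, Real.norm_eq_abs, abs_of_pos (by norm_num)]
  refine (Metric.measure_ball_pos volume p₀ (by norm_num : (0 : ℝ) < 1 / 50)).trans_le (measure_mono ?_)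
  intro p hp
  rw [Metric.mem_ball, dist_eq_norm] at hp
  have h1 : ‖p‖ ≤ ‖p - p₀‖ + ‖p₀‖ := norm_le_norm_sub_add p p₀
  have h2 : ‖p₀‖ - ‖p‖ ≤ ‖p - p₀‖ := by rw [norm_sub_rev]; exact norm_sub_norm_le p₀ p
  have hp0 : 0 ≤ ‖p‖ := norm_nonneg p
  refine ⟨⟨by nlinarith, by nlinarith⟩, ?_⟩
  rw [Metric.mem_ball, dist_zero_right]
  linarith

/-- The area of the annulus is finite. [folklore] -/
theorem zoneArea_lt_top :
    volume ({p : EuclideanSpace ℝ (Fin 2) | 7 / 16 ≤ ‖p‖ ^ 2 ∧ ‖p‖ ^ 2 ≤ 231 / 400} ∩ Metric.ball 0 1) < ∞ :=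
  (measure_mono Set.inter_subset_right).trans_lt measure_ball_lt_top

/-! ## The sphere-integrated mark on the splitting zone -/

/-- **The sphere-integrated mark dominates the flux of the splitting zone**: if the nonnegative bounded
measurable mark `Ξ(·, v, w)` is `1` on the zone `13/20 ≤ ⟪a, ω⟫ ≤ 3/4` (`a = ‖w − v‖⁻¹ (w − v)`, `w ≠ v`),
then `‖w − v‖ · c_Z ≤ Θ Ξ (v, w)`. [folklore] -/
theorem sphereMark_ge_of_zone {Ξ : V3 × V3 × V3 → ℝ} (hΞm : Measurable Ξ) (hΞ0 : ∀ p, 0 ≤ Ξ p) {C : ℝ}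
    (hΞC : ∀ p, Ξ p ≤ C) {v w : V3} (hvw : 0 < ‖w - v‖)
    (hzone : ∀ ω : V3, ‖ω‖ = 1 → 13 / 20 ≤ ⟪‖w - v‖⁻¹ • (w - v), ω⟫_ℝ →
      ⟪‖w - v‖⁻¹ • (w - v), ω⟫_ℝ ≤ 3 / 4 → Ξ (ω, v, w) = 1) :
    ‖w - v‖ * (volume ({p : EuclideanSpace ℝ (Fin 2) | 7 / 16 ≤ ‖p‖ ^ 2 ∧ ‖p‖ ^ 2 ≤ 231 / 400} ∩
        Metric.ball 0 1)).toReal ≤ sphereMark Ξ v w := by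
  haveI := isFiniteMeasure_sphereMeasure (E := V3)
  set a : V3 := ‖w - v‖⁻¹ • (w - v) with hadef
  have ha : ‖a‖ = 1 := by
    rw [hadef, norm_smul, norm_inv, norm_norm, inv_mul_cancel₀ hvw.ne']
  have hga : w - v = ‖w - v‖ • a := by rw [hadef, smul_smul, mul_inv_cancel₀ hvw.ne', one_smul]
  set G : Metric.sphere (0 : V3) 1 → ℝ := fun ω =>
    ‖w - v‖ * (Set.Icc (13 / 20 : ℝ) (3 / 4)).indicator id ⟪a, (ω : V3)⟫_ℝ with hGdef
  have hind0 : ∀ t : ℝ, 0 ≤ (Set.Icc (13 / 20 : ℝ) (3 / 4)).indicator id t := fun t =>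
    Set.indicator_nonneg (fun t ht => by rw [id]; linarith [ht.1]) _
  have hG0 : ∀ ω, 0 ≤ G ω := fun ω => mul_nonneg hvw.le (hind0 _)
  have hinm : Measurable fun ω : Metric.sphere (0 : V3) 1 => ⟪a, (ω : V3)⟫_ℝ :=
    (continuous_const.inner continuous_subtype_val).measurable
  set F : Metric.sphere (0 : V3) 1 → ℝ := fun ω => Ξ ((ω : V3), v, w) * hardSphereKernel (w, v) ω with hFdef
  have hFm : Measurable F := (hΞm.comp (continuous_subtype_val.measurable.prodMk measurable_const)).mul
    (by unfold hardSphereKernel; fun_prop)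
  have hC0 : 0 ≤ C := (hΞ0 (0, 0, 0)).trans (hΞC _)
  have hFb : ∀ ω, ‖F ω‖ ≤ C * ‖w - v‖ := fun ω => by
    obtain ⟨hk0, hk1⟩ := hardSphereKernel_nonneg_le v w ω
    rw [Real.norm_eq_abs, hFdef, abs_mul, abs_of_nonneg (hΞ0 _), abs_of_nonneg hk0]
    exact mul_le_mul (hΞC _) hk1 hk0 hC0
  have hFi : Integrable F (sphereMeasure : Measure (Metric.sphere (0 : V3) 1)) :=
    Integrable.of_bound hFm.aestronglyMeasurable _ (ae_of_all _ hFb)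
  have hGF : ∀ ω, G ω ≤ F ω := fun ω => by
    have hω : ‖(ω : V3)‖ = 1 := by simp
    by_cases h : ⟪a, (ω : V3)⟫_ℝ ∈ Set.Icc (13 / 20 : ℝ) (3 / 4)
    · have hΞ1 : Ξ ((ω : V3), v, w) = 1 := hzone ω hω h.1 h.2
      have hk : hardSphereKernel (w, v) ω = ‖w - v‖ * ⟪a, (ω : V3)⟫_ℝ := by
        unfold hardSphereKernel; dsimp only
        rw [hga, real_inner_smul_left, norm_smul, norm_norm, ha, mul_one, max_eq_left]
        exact mul_nonneg hvw.le (by linarith [h.1])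
      simp only [hGdef, hFdef, Set.indicator_of_mem h, id, hΞ1, one_mul, hk, le_refl]
    · simp only [hGdef, Set.indicator_of_notMem h, mul_zero, hFdef]
      exact mul_nonneg (hΞ0 _) (hardSphereKernel_nonneg_le v w ω).1
  have hmono : ∫ ω, G ω ∂sphereMeasure ≤ sphereMark Ξ v w :=
    integral_mono_of_nonneg (ae_of_all _ hG0) hFi (ae_of_all _ hGF)
  -- the integral of the minorant is the flux of the zone
  have hGint : ∫ ω, G ω ∂sphereMeasure = ‖w - v‖ *
      (volume ({p : EuclideanSpace ℝ (Fin 2) | 7 / 16 ≤ ‖p‖ ^ 2 ∧ ‖p‖ ^ 2 ≤ 231 / 400} ∩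
        Metric.ball 0 1)).toReal := by
    rw [hGdef, integral_const_mul, ← lintegral_zoneFlux_eq ha,
      integral_eq_lintegral_of_nonneg_ae (ae_of_all _ fun ω => hind0 _)
        ((measurable_id.indicator measurableSet_Icc).comp hinm).aestronglyMeasurable]
    congr 2; refine lintegral_congr fun ω => ?_
    by_cases h : ⟪a, (ω : V3)⟫_ℝ ∈ Set.Icc (13 / 20 : ℝ) (3 / 4)
    · rw [Set.indicator_of_mem h, Set.indicator_of_mem h, id, Pi.one_apply, mul_one]
    · rw [Set.indicator_of_notMem h, Set.indicator_of_notMem h, mul_zero, ENNReal.ofReal_zero]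
  exact hGint ▸ hmono

/-! ## The geometric floor -/

/-- The sphere-integrated mark of a measurable mark is jointly measurable in `(v, w)` (Fubini measurability;
the public copy lives in the sibling file `…SplitFloorRung0TubeMean`). [folklore] -/
private theorem measurable_sphereMark_aux {Ξ : V3 × V3 × V3 → ℝ} (hΞ : Measurable Ξ) :
    Measurable fun p : V3 × V3 => sphereMark Ξ p.1 p.2 := by
  haveI := isFiniteMeasure_sphereMeasure (E := V3)
  have hm : Measurable (uncurry fun (p : V3 × V3) (ω : Metric.sphere (0 : V3) 1) =>
      Ξ ((ω : V3), p.1, p.2) * hardSphereKernel (p.2, p.1) ω) := by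
    have h1 : Measurable fun q : (V3 × V3) × Metric.sphere (0 : V3) 1 =>
        Ξ ((q.2 : V3), q.1.1, q.1.2) :=
      hΞ.comp ((continuous_subtype_val.comp continuous_snd).measurable.prodMk
        (measurable_fst.fst.prodMk measurable_fst.snd))
    exact h1.mul (by unfold hardSphereKernel; fun_prop)
  exact (hm.stronglyMeasurable.integral_prod_right'
    (ν := (sphereMeasure : Measure (Metric.sphere (0 : V3) 1)))).measurable

/-- A Maxwellian partner is slow with probability at least one half: `N(u,θ){‖w‖ < R} ≥ 1/2` for
`R² = 2(‖u‖² + 3θ) + 1` (Chebyshev, second moment `‖u‖² + 3θ`). [folklore] -/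
theorem gaussMeasure_slow_ge_half (u : V3) {θ : ℝ} (hθ : 0 < θ) :
    1 / 2 ≤ (gaussMeasure u θ {w : V3 | ‖w‖ < Real.sqrt (2 * (‖u‖ ^ 2 + 3 * θ) + 1)}).toReal := by
  set γ := gaussMeasure u θ with hγ
  set m : ℝ := ‖u‖ ^ 2 + 3 * θ with hm
  set R : ℝ := Real.sqrt (2 * m + 1) with hR
  have hR0 : 0 < R := Real.sqrt_pos.2 (by positivity)
  have hR2 : R ^ 2 = 2 * m + 1 := Real.sq_sqrt (by positivity)
  set B : Set V3 := {w | ‖w‖ < R} with hBdef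
  have hBm : MeasurableSet B := measurableSet_lt continuous_norm.measurable measurable_const
  have hBc : γ Bᶜ ≤ ENNReal.ofReal (1 / 2) := by
    have hsub : Bᶜ ⊆ {w : V3 | ENNReal.ofReal (R ^ 2) ≤ ENNReal.ofReal (‖w‖ ^ 2)} := by
      intro w hw
      simp only [hBdef, Set.mem_compl_iff, Set.mem_setOf_eq, not_lt] at hw
      exact ENNReal.ofReal_le_ofReal (pow_le_pow_left₀ hR0.le hw 2)
    have hf : Measurable fun w : V3 => ENNReal.ofReal (‖w‖ ^ 2) := by fun_prop
    have hmk := meas_ge_le_lintegral_div (μ := γ) hf.aemeasurable (ε := ENNReal.ofReal (R ^ 2))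
      (ENNReal.ofReal_pos.2 (by positivity)).ne' ENNReal.ofReal_ne_top
    rw [hγ, lintegral_norm_sq_gaussMeasure u hθ] at hmk
    calc γ Bᶜ ≤ γ {w : V3 | ENNReal.ofReal (R ^ 2) ≤ ENNReal.ofReal (‖w‖ ^ 2)} := measure_mono hsub
      _ ≤ ENNReal.ofReal (‖u‖ ^ 2 + 3 * θ) / ENNReal.ofReal (R ^ 2) := hmk
      _ = ENNReal.ofReal (m / R ^ 2) := (ENNReal.ofReal_div_of_pos (by positivity)).symm
      _ ≤ ENNReal.ofReal (1 / 2) := ENNReal.ofReal_le_ofReal (by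
          rw [hR2, div_le_iff₀ (by positivity)]; nlinarith [sq_nonneg ‖u‖])
  have hprob : γ B = 1 - γ Bᶜ := by simpa only [compl_compl] using prob_compl_eq_one_sub (μ := γ) hBm.compl
  have h1 : ENNReal.ofReal (1 / 2) ≤ γ B := by
    rw [hprob]
    calc ENNReal.ofReal (1 / 2) = 1 - ENNReal.ofReal (1 / 2) := by
          rw [← ENNReal.ofReal_one, ← ENNReal.ofReal_sub _ (by norm_num)]; norm_num
      _ ≤ 1 - γ Bᶜ := tsub_le_tsub_left hBc 1
  have := ENNReal.toReal_mono (measure_ne_top γ B) h1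
  rwa [ENNReal.toReal_ofReal (by norm_num)] at this

/-- **Registered helper `splitFloorRung0_geometry`** (stmt-AtomisticToContinuum-9235, line `level-census-comparison`,
input of `stub_splitFloorRung0`): for `θ > 0`, `u` there are `c, Eth > 0` such that for every `E ≥ Eth` some
measurable mark `Ξ : (n, v, w) ↦ {0, 1}` (i) is nonzero only on the splitting geometry of level `E` for the
outgoing pair `(v − ⟪v − w, n⟫ n, w + ⟪v − w, n⟫ n)`, (ii) vanishes at relative speed `≥ 4√E` and at speed
`‖v‖ ≥ 4√E`, (iii) has ideal tube mean `Θ̄_Ξ ≥ c √E · N(u,θ)(E < ‖v‖² ≤ 3E/2)`. [folklore] -/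
theorem splitFloorRung0_geometry : ∀ (θ : ℝ) (u : V3), 0 < θ → ∃ c Eth : ℝ, 0 < c ∧ 0 < Eth ∧ ∀ E : ℝ, Eth ≤ E → ∃ Ξ : V3 × V3 × V3 → ℝ, Measurable Ξ ∧ (∀ p, 0 ≤ Ξ p) ∧ (∀ p, Ξ p ≤ 1) ∧ (∀ (n v w : V3), Ξ (n, v, w) ≠ 0 → E < max (‖v‖ ^ 2) (‖w‖ ^ 2) ∧ max (‖v‖ ^ 2) (‖w‖ ^ 2) ≤ 3 / 2 * E ∧ ‖v - ⟪v - w, n⟫_ℝ • n‖ ^ 2 ≤ E ∧ ‖w + ⟪v - w, n⟫_ℝ • n‖ ^ 2 ≤ E) ∧ (∀ (n v w : V3), 2 * (2 * Real.sqrt E) ≤ ‖v - w‖ → Ξ (n, v, w) = 0) ∧ (∀ (n v w : V3), 2 * (2 * Real.sqrt E) ≤ ‖v‖ → Ξ (n, v, w) = 0) ∧ c * Real.sqrt E * (gaussMeasure u θ {v : V3 | E < ‖v‖ ^ 2 ∧ ‖v‖ ^ 2 ≤ 3 / 2 * E}).toReal ≤ ∫ p : V3 × V3, sphereMark Ξ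 p.1 p.2 * (localMaxwellian 1 θ u p.1 * localMaxwellian 1 θ u p.2) := by
  intro θ u hθ
  -- constants
  set R : ℝ := Real.sqrt (2 * (‖u‖ ^ 2 + 3 * θ) + 1) with hR
  have hR0 : 0 < R := Real.sqrt_pos.2 (by positivity)
  set cZ : ℝ≥0∞ := volume ({p : EuclideanSpace ℝ (Fin 2) | 7 / 16 ≤ ‖p‖ ^ 2 ∧ ‖p‖ ^ 2 ≤ 231 / 400} ∩
    Metric.ball 0 1) with hcZ
  have hcZr : 0 < cZ.toReal := ENNReal.toReal_pos zoneArea_pos.ne' zoneArea_lt_top.ne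
  refine ⟨cZ.toReal / 4, (40 * R) ^ 2 + 1, by positivity, by positivity, ?_⟩
  intro E hE
  have hE0 : 0 < E := by nlinarith [sq_nonneg (40 * R)]
  set e := Real.sqrt E with he
  have he0 : 0 < e := Real.sqrt_pos.2 hE0
  have hee : e ^ 2 = E := Real.sq_sqrt hE0.le
  have hRe : 40 * R ≤ e := by
    rw [he, ← Real.sqrt_sq (by positivity : 0 ≤ 40 * R)]; exact Real.sqrt_le_sqrt (by linarith)
  -- the mark
  set A : Set (V3 × V3 × V3) := {p | E < max (‖p.2.1‖ ^ 2) (‖p.2.2‖ ^ 2) ∧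
      max (‖p.2.1‖ ^ 2) (‖p.2.2‖ ^ 2) ≤ 3 / 2 * E ∧
      ‖p.2.1 - ⟪p.2.1 - p.2.2, p.1⟫_ℝ • p.1‖ ^ 2 ≤ E ∧ ‖p.2.2 + ⟪p.2.1 - p.2.2, p.1⟫_ℝ • p.1‖ ^ 2 ≤ E ∧
      ‖p.2.1 - p.2.2‖ < 2 * (2 * e) ∧ ‖p.2.1‖ < 2 * (2 * e)} with hAdef
  have hA : MeasurableSet A := by
    have h1 : Measurable fun p : V3 × V3 × V3 => max (‖p.2.1‖ ^ 2) (‖p.2.2‖ ^ 2) := by fun_prop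
    have h2 : Measurable fun p : V3 × V3 × V3 => ‖p.2.1 - ⟪p.2.1 - p.2.2, p.1⟫_ℝ • p.1‖ ^ 2 := by fun_prop
    have h3 : Measurable fun p : V3 × V3 × V3 => ‖p.2.2 + ⟪p.2.1 - p.2.2, p.1⟫_ℝ • p.1‖ ^ 2 := by fun_prop
    have h4 : Measurable fun p : V3 × V3 × V3 => ‖p.2.1 - p.2.2‖ := by fun_prop
    have h5 : Measurable fun p : V3 × V3 × V3 => ‖p.2.1‖ := by fun_prop
    simp only [hAdef, Set.setOf_and]
    exact (measurableSet_lt measurable_const h1).inter ((measurableSet_le h1 measurable_const).inter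
      ((measurableSet_le h2 measurable_const).inter ((measurableSet_le h3 measurable_const).inter
      ((measurableSet_lt h4 measurable_const).inter (measurableSet_lt h5 measurable_const)))))
  set Ξ : V3 × V3 × V3 → ℝ := A.indicator fun _ => 1 with hΞdef
  have hΞm : Measurable Ξ := measurable_const.indicator hA
  have hΞ01 : ∀ p, 0 ≤ Ξ p ∧ Ξ p ≤ 1 := fun p => by
    by_cases hp : p ∈ A
    · simp only [hΞdef, Set.indicator_of_mem hp]; norm_num
    · simp only [hΞdef, Set.indicator_of_notMem hp]; norm_num
  have hΞ0 : ∀ p, 0 ≤ Ξ p := fun p => (hΞ01 p).1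
  have hΞabs : ∀ p, |Ξ p| ≤ 1 := fun p => by rw [abs_of_nonneg (hΞ0 p)]; exact (hΞ01 p).2
  have hout : ∀ p, p ∉ A → Ξ p = 0 := fun p hp => by simp only [hΞdef, Set.indicator_of_notMem hp]
  have hΞL : ∀ n v w : V3, 2 * (2 * e) ≤ ‖v - w‖ → Ξ (n, v, w) = 0 := fun n v w h =>
    hout _ fun hp => by have h' := hp.2.2.2.2.1; dsimp only at h'; linarith
  have hΞV : ∀ n v w : V3, 2 * (2 * e) ≤ ‖v‖ → Ξ (n, v, w) = 0 := fun n v w h =>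
    hout _ fun hp => by have h' := hp.2.2.2.2.2; dsimp only at h'; linarith
  refine ⟨Ξ, hΞm, hΞ0, fun p => (hΞ01 p).2, ?_, hΞL, hΞV, ?_⟩
  · intro n v w hne
    have hp : ((n, v, w) : V3 × V3 × V3) ∈ A := by by_contra hp; exact hne (hout _ hp)
    exact ⟨hp.1, hp.2.1, hp.2.2.1, hp.2.2.2.1⟩
  -- the floor
  set γ := gaussMeasure u θ with hγ
  set S : Set V3 := {v | E < ‖v‖ ^ 2 ∧ ‖v‖ ^ 2 ≤ 3 / 2 * E} with hSdef
  set B : Set V3 := {w | ‖w‖ < R} with hBdef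
  have hn2 : Measurable fun v : V3 => ‖v‖ ^ 2 := by fun_prop
  have hSm : MeasurableSet S := by
    simp only [hSdef, Set.setOf_and]
    exact (measurableSet_lt measurable_const hn2).inter (measurableSet_le hn2 measurable_const)
  have hBm : MeasurableSet B := measurableSet_lt continuous_norm.measurable measurable_const
  -- (1) pointwise on `S × B`
  have hpt : ∀ v ∈ S, ∀ w ∈ B, e / 2 * cZ.toReal ≤ sphereMark Ξ v w := by
    intro v hv w hw
    have hv1 : e ^ 2 < ‖v‖ ^ 2 := by rw [hee]; exact hv.1
    have hv2 : ‖v‖ ^ 2 ≤ 3 / 2 * e ^ 2 := by rw [hee]; exact hv.2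
    have hw' : ‖w‖ < R := hw
    have hvn : e < ‖v‖ := lt_of_pow_lt_pow_left₀ 2 (norm_nonneg _) hv1
    have h1 : ‖v‖ - ‖w‖ ≤ ‖w - v‖ := by rw [norm_sub_rev]; exact norm_sub_norm_le v w
    have hgap : e / 2 ≤ ‖w - v‖ := by linarith
    have hvw : 0 < ‖w - v‖ := by linarith
    have hzone1 : ∀ ω : V3, ‖ω‖ = 1 → 13 / 20 ≤ ⟪‖w - v‖⁻¹ • (w - v), ω⟫_ℝ →
        ⟪‖w - v‖⁻¹ • (w - v), ω⟫_ℝ ≤ 3 / 4 → Ξ (ω, v, w) = 1 := by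
      intro ω hω h1 h2
      have hs := split_of_zone hR0 hRe hv1 hv2 hw' hω h1 h2
      have hmem : ((ω, v, w) : V3 × V3 × V3) ∈ A := by simp only [hAdef, Set.mem_setOf_eq]; rw [← hee]; exact hs
      simp only [hΞdef, Set.indicator_of_mem hmem]
    have hz := sphereMark_ge_of_zone hΞm hΞ0 (fun p => (hΞ01 p).2) hvw hzone1
    calc e / 2 * cZ.toReal ≤ ‖w - v‖ * cZ.toReal := mul_le_mul_of_nonneg_right hgap hcZr.le
      _ ≤ sphereMark Ξ v w := hz
  -- (2) integrate against `N(u,θ) ⊗ N(u,θ)`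
  have hΘm : Measurable fun p : V3 × V3 => sphereMark Ξ p.1 p.2 := measurable_sphereMark_aux hΞm
  have hΘb : ∀ p : V3 × V3, ‖sphereMark Ξ p.1 p.2‖ ≤
      1 * (2 * (2 * e)) * (sphereMeasure : Measure (Metric.sphere (0 : V3) 1)).real univ := fun p => by
    rw [Real.norm_eq_abs]
    exact abs_sphereMark_le_of_speedCutoff hΞabs (by positivity) hΞL p.1 p.2
  have hΘi : Integrable (fun p : V3 × V3 => sphereMark Ξ p.1 p.2) (γ.prod γ) :=
    Integrable.of_bound hΘm.aestronglyMeasurable _ (ae_of_all _ hΘb)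
  have hind : ∀ p : V3 × V3, (S ×ˢ B).indicator (fun _ => e / 2 * cZ.toReal) p ≤ sphereMark Ξ p.1 p.2 := fun p => by
    by_cases hp : p ∈ S ×ˢ B
    · rw [Set.indicator_of_mem hp]; exact hpt p.1 hp.1 p.2 hp.2
    · rw [Set.indicator_of_notMem hp]; exact sphereMark_nonneg hΞ0 _ _
  have hind0 : ∀ p : V3 × V3, 0 ≤ (S ×ˢ B).indicator (fun _ => e / 2 * cZ.toReal) p := fun p =>
    Set.indicator_nonneg (fun _ _ => by positivity) _
  have hmono := integral_mono_of_nonneg (ae_of_all _ hind0) hΘi (ae_of_all _ hind)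
  rw [integral_indicator_const _ (hSm.prod hBm), measureReal_def, Measure.prod_prod, ENNReal.toReal_mul,
    smul_eq_mul] at hmono
  -- (3) the slow partner, conclusion
  have hB : 1 / 2 ≤ (γ B).toReal := gaussMeasure_slow_ge_half u hθ
  rw [← integral_prod_gaussMeasure hθ u (fun p : V3 × V3 => sphereMark Ξ p.1 p.2)]
  calc cZ.toReal / 4 * e * (γ S).toReal = (e / 2 * cZ.toReal) * (γ S).toReal * (1 / 2) := by ring
    _ ≤ (e / 2 * cZ.toReal) * (γ S).toReal * (γ B).toReal := mul_le_mul_of_nonneg_left hB (by positivity)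
    _ = (γ S).toReal * (γ B).toReal * (e / 2 * cZ.toReal) := by ring
    _ ≤ ∫ p, sphereMark Ξ p.1 p.2 ∂(γ.prod γ) := hmono

end Summit.AtomisticToContinuum.HydrodynamicLimit.Theorems.EnergyCurrentTailsLevelCensus

end
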